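import Mathlib.Analysis.SpecialFunctions.Gaussian.GaussianIntegral
import Mathlib.Analysis.SpecialFunctions.Integrals.Basic
import Literature.NumberTheory.LFunctions.VinogradovKorobov
import HarnessLib

/-!
# Ford's bound for `ζ(s)`: the constant of the dyadic integral comparison (the `κ`-lemma)

Topic `Literature/NumberTheory/LFunctions`. Second file of the PROVED deduction "Theorem 2 ⟹
Theorem 1" of K. Ford, *Vinogradov's integral and bounds for the Riemann zeta function*, Proc.
London Math. Soc. (3) 85 (2002), 565–633 (arXiv:1910.08209), i.e. of Lemma 7.3 of the source, for the
named fact `Literature.NumberTheory.LFunctions.zeta_bound_ford` (`VinogradovKorobov.lean`); see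
`FordZetaBoundMain.lean` for the architecture. Everything here is proved; no definitions.

In the proof of Lemma 7.3 the dyadic block sums `∑_j e^{g(j)}`,
`g(x) = (1−σ) x log 2 − (x log 2)³/(D log² t)`, are compared with an integral, and after the
substitution `x log 2 = u D^{1/3} log^{2/3} t`, `(1 − σ) D^{1/3} log^{2/3} t = 3y²`, the source needs
the numerical fact `e^{−2y³} ∫_0^∞ e^{3y²u − u³} du ≤ 1.0875034` (`y ≥ 0`), whose certification to the
precision that the printed constant `A = 76.2` requires (relative `1.5·10⁻⁴`) is out of reach of
elementary estimates. The in-tree deduction instead bounds each dyadic block by the MINIMUM of the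
trivial bound and the bound from Theorem 2 (Theorem 2, `S(N,t) ≤ C N^{1−1/(Dλ²)}` with `C = 9.463`,
is weaker than the trivial bound `S(N,t) ≤ N` exactly when `u < (log C)^{1/3} = 1.3098`), which
replaces Ford's constant `C · 1.0875` by

  `κ(y) = e^{−2y³} ∫_0^{u*} e^{3y²u} du + C ∫_{u*}^{V} e^{−(u−y)²(u+2y)} du`,  `u* = 1.3`, any `V ≥ u*`,

(`3y²u − u³ − 2y³ = −(u − y)²(u + 2y)`), whose supremum is `≈ 7.06` (at `y ≈ 1.75`) against the
`10.29` of the source. This file proves `κ(y) ≤ 10` for all `y ≥ 0` (`FordVK.kappa_le`) from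
closed-form majorants on seven `y`-cells: `∫_0^{u*} e^{3y²u} du = (e^{3y²u*} − 1)/(3y²)`,
`e^{3y²u* − 2y³} ≤ e^{u*³}`, and for the second integral the Gaussian comparisons
`(u − y)²(u + 2y) ≥ (u* + 2y)(u − y)²` (`u ≥ u*`), `≥ 3y (u − y)²` (`u ≥ y`) together with
`∫_0^∞ e^{−m v²} dv = √(π/m)/2` (`integral_gaussian_Ioi`) and the tail bound
`∫_d^∞ e^{−m v²} dv ≤ e^{−m d²}/(2 m d)`.

## References

* K. Ford, Proc. London Math. Soc. (3) 85 (2002), 565–633; arXiv:1910.08209 — Lemma 7.3 and its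
  proof (the inequality `e^{−2y³}∫_0^∞ e^{3y²u−u³} du ≤ 1.0875034`). (`Ford2002`)
-/

noncomputable section

open Real MeasureTheory Set intervalIntegral

namespace Literature.NumberTheory.LFunctions

namespace FordVK

/-! ## Elementary integrals -/

/-- `∫_0^c e^{k u} du = (e^{k c} − 1)/k` for `k ≠ 0`. [folklore] -/
theorem integral_exp_const_mul {k : ℝ} (hk : k ≠ 0) (c : ℝ) :
    ∫ u in (0 : ℝ)..c, Real.exp (k * u) = (Real.exp (k * c) - 1) / k := by
  have hderiv : ∀ x ∈ uIcc (0 : ℝ) c,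
      HasDerivAt (fun u ↦ Real.exp (k * u) / k) (Real.exp (k * x)) x := by
    intro x _
    have h1 : HasDerivAt (fun u : ℝ ↦ k * u) k x := by
      simpa using (hasDerivAt_id x).const_mul k
    exact (h1.exp.div_const k).congr_deriv (by field_simp)
  rw [integral_eq_sub_of_hasDerivAt hderiv
    ((by fun_prop : Continuous fun u ↦ Real.exp (k * u)).intervalIntegrable _ _)]
  rw [mul_zero, Real.exp_zero]
  ring

/-- `∫_0^c e^{k u} du ≤ e^{k c}/k` for `k > 0`. [folklore] -/
theorem integral_exp_const_mul_le {k : ℝ} (hk : 0 < k) (c : ℝ) :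
    ∫ u in (0 : ℝ)..c, Real.exp (k * u) ≤ Real.exp (k * c) / k := by
  rw [integral_exp_const_mul hk.ne' c]
  apply div_le_div_of_nonneg_right _ hk.le
  linarith

/-- The tail of a Gaussian integral: `∫_d^e e^{−m v²} dv ≤ e^{−m d²}/(2 m d)` for `m, d > 0`,
`d ≤ e`, from `e^{−m v²} ≤ (v/d) e^{−m v²}` on `[d, e]`. [folklore] -/
theorem integral_gaussian_tail_le {m d e : ℝ} (hm : 0 < m) (hd : 0 < d) (hde : d ≤ e) :
    ∫ v in d..e, Real.exp (-m * v ^ 2) ≤ Real.exp (-m * d ^ 2) / (2 * m * d) := by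
  have hmono : ∫ v in d..e, Real.exp (-m * v ^ 2)
      ≤ ∫ v in d..e, v / d * Real.exp (-m * v ^ 2) := by
    refine integral_mono_on hde
      ((by fun_prop : Continuous fun v ↦ Real.exp (-m * v ^ 2)).intervalIntegrable _ _)
      ((by fun_prop : Continuous fun v ↦ v / d * Real.exp (-m * v ^ 2)).intervalIntegrable _ _) ?_
    intro v hv
    have h1 : 1 ≤ v / d := by rw [le_div_iff₀ hd]; linarith [hv.1]
    have h2 : 0 < Real.exp (-m * v ^ 2) := Real.exp_pos _
    nlinarith
  have hderiv : ∀ x ∈ uIcc d e,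
      HasDerivAt (fun v ↦ Real.exp (-m * v ^ 2) / (-(2 * m * d))) (x / d * Real.exp (-m * x ^ 2)) x := by
    intro x _
    have h1 : HasDerivAt (fun v : ℝ ↦ -m * v ^ 2) (-m * (2 * x)) x := by
      simpa using (hasDerivAt_pow 2 x).const_mul (-m)
    exact (h1.exp.div_const (-(2 * m * d))).congr_deriv (by field_simp)
  set A : ℝ := Real.exp (-m * d ^ 2) / (2 * m * d) with hA
  set B : ℝ := Real.exp (-m * e ^ 2) / (2 * m * d) with hB
  have hval : ∫ v in d..e, v / d * Real.exp (-m * v ^ 2) = A - B := by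
    rw [integral_eq_sub_of_hasDerivAt hderiv
      ((by fun_prop : Continuous fun v ↦ v / d * Real.exp (-m * v ^ 2)).intervalIntegrable _ _)]
    rw [hA, hB, div_neg, div_neg]; ring
  rw [hval] at hmono
  have h3 : 0 ≤ B := by rw [hB]; positivity
  linarith

/-- A finite piece of a Gaussian integral on the positive axis is at most `√(π/m)/2`:
`∫_d^e e^{−m v²} dv ≤ √(π/m)/2` for `0 ≤ d ≤ e`, `m > 0` (`integral_gaussian_Ioi`). [folklore] -/
theorem integral_gaussian_piece_le {m d e : ℝ} (hm : 0 < m) (hd : 0 ≤ d) (hde : d ≤ e) :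
    ∫ v in d..e, Real.exp (-m * v ^ 2) ≤ Real.sqrt (π / m) / 2 := by
  have hint : IntegrableOn (fun v ↦ Real.exp (-m * v ^ 2)) (Ioi 0) :=
    (integrable_exp_neg_mul_sq hm).integrableOn
  rw [integral_of_le hde, ← integral_gaussian_Ioi m]
  refine setIntegral_mono_set hint ?_ ?_
  · exact ae_of_all _ fun v ↦ (Real.exp_pos _).le
  · exact ae_of_all _ fun v hv ↦ lt_of_le_of_lt hd hv.1

/-! ## The two terms of `κ(y)` -/

/-- The identity behind the Gaussian comparison: `3y²u − u³ − 2y³ = −(u − y)²(u + 2y)`, in the form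
`e^{−2y³} e^{3y²u − u³} = e^{−(u−y)²(u+2y)}`. [cite: Ford2002, Lemma 7.3 (proof)] -/
theorem exp_neg_two_cube_mul_exp (y u : ℝ) :
    Real.exp (-2 * y ^ 3) * Real.exp (3 * y ^ 2 * u - u ^ 3)
      = Real.exp (-((u - y) ^ 2 * (u + 2 * y))) := by
  rw [← Real.exp_add]; congr 1; ring

/-- First term, small `y`: for `0 ≤ y ≤ y₁`,
`e^{−2y³} ∫_0^{13/10} e^{3y²u} du ≤ (e^{3y₁²·(13/10)} − 1)/(3y₁²)`. [folklore] -/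
theorem term1_le_of_le {y y₁ : ℝ} (hy : 0 ≤ y) (hy₁ : y ≤ y₁) (hy₁0 : 0 < y₁) :
    Real.exp (-2 * y ^ 3) * ∫ u in (0 : ℝ)..13 / 10, Real.exp (3 * y ^ 2 * u)
      ≤ (Real.exp (3 * y₁ ^ 2 * (13 / 10)) - 1) / (3 * y₁ ^ 2) := by
  have hI0 : 0 ≤ ∫ u in (0 : ℝ)..13 / 10, Real.exp (3 * y ^ 2 * u) :=
    integral_nonneg (by norm_num) fun u _ ↦ (Real.exp_pos _).le
  have h1 : Real.exp (-2 * y ^ 3) ≤ 1 := by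
    rw [Real.exp_le_one_iff]; nlinarith [pow_nonneg hy 3]
  have h2 : ∫ u in (0 : ℝ)..13 / 10, Real.exp (3 * y ^ 2 * u)
      ≤ ∫ u in (0 : ℝ)..13 / 10, Real.exp (3 * y₁ ^ 2 * u) := by
    refine integral_mono_on (by norm_num)
      ((by fun_prop : Continuous fun u ↦ Real.exp (3 * y ^ 2 * u)).intervalIntegrable _ _)
      ((by fun_prop : Continuous fun u ↦ Real.exp (3 * y₁ ^ 2 * u)).intervalIntegrable _ _) ?_
    intro u hu
    apply Real.exp_le_exp.2
    have : y ^ 2 ≤ y₁ ^ 2 := pow_le_pow_left₀ hy hy₁ 2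
    nlinarith [hu.1]
  have h3 := integral_exp_const_mul (k := 3 * y₁ ^ 2) (by positivity) (13 / 10)
  calc Real.exp (-2 * y ^ 3) * ∫ u in (0 : ℝ)..13 / 10, Real.exp (3 * y ^ 2 * u)
      ≤ 1 * ∫ u in (0 : ℝ)..13 / 10, Real.exp (3 * y ^ 2 * u) :=
        mul_le_mul_of_nonneg_right h1 hI0
    _ ≤ _ := by rw [one_mul, ← h3]; exact h2

/-- First term, `y ≥ y₀ > 0`: `e^{−2y³} ∫_0^{13/10} e^{3y²u} du ≤ e^{(13/10)³}/(3y₀²)`, by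
`e^{3y²u* − 2y³} ≤ e^{u*³}` (`u*³ − 3u*y² + 2y³ = (u* − y)²(u* + 2y) ≥ 0`). [folklore] -/
theorem term1_le_of_ge {y y₀ : ℝ} (hy₀ : 0 < y₀) (hy : y₀ ≤ y) :
    Real.exp (-2 * y ^ 3) * ∫ u in (0 : ℝ)..13 / 10, Real.exp (3 * y ^ 2 * u)
      ≤ Real.exp ((13 / 10) ^ 3) / (3 * y₀ ^ 2) := by
  have hy' : 0 < y := hy₀.trans_le hy
  have hk : 0 < 3 * y ^ 2 := by positivity
  have h1 := integral_exp_const_mul_le hk (13 / 10)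
  have h2 : Real.exp (-2 * y ^ 3) * (Real.exp (3 * y ^ 2 * (13 / 10)) / (3 * y ^ 2))
      = Real.exp (3 * y ^ 2 * (13 / 10) - 2 * y ^ 3) / (3 * y ^ 2) := by
    rw [mul_div_assoc', ← Real.exp_add]; ring_nf
  have h3 : Real.exp (3 * y ^ 2 * (13 / 10) - 2 * y ^ 3) ≤ Real.exp ((13 / 10) ^ 3) := by
    apply Real.exp_le_exp.2
    nlinarith [mul_nonneg (sq_nonneg (13 / 10 - y)) (by linarith : 0 ≤ 13 / 10 + 2 * y)]
  calc Real.exp (-2 * y ^ 3) * ∫ u in (0 : ℝ)..13 / 10, Real.exp (3 * y ^ 2 * u)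
      ≤ Real.exp (-2 * y ^ 3) * (Real.exp (3 * y ^ 2 * (13 / 10)) / (3 * y ^ 2)) :=
        mul_le_mul_of_nonneg_left h1 (Real.exp_pos _).le
    _ = Real.exp (3 * y ^ 2 * (13 / 10) - 2 * y ^ 3) / (3 * y ^ 2) := h2
    _ ≤ Real.exp ((13 / 10) ^ 3) / (3 * y ^ 2) := div_le_div_of_nonneg_right h3 hk.le
    _ ≤ Real.exp ((13 / 10) ^ 3) / (3 * y₀ ^ 2) := by
        apply div_le_div_of_nonneg_left (Real.exp_pos _).le (by positivity)
        nlinarith [mul_pos hy₀ hy']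

/-- First term, `y ≥ y₀ ≥ 13/10`: `e^{−2y³} ∫_0^{13/10} e^{3y²u} du ≤ e^{3y₀²u* − 2y₀³}/(3y₀²)`
(`p(y) = 3y²u* − 2y³` is non-increasing on `[u*, ∞)`). [folklore] -/
theorem term1_le_of_ge' {y y₀ : ℝ} (hy₀ : 13 / 10 ≤ y₀) (hy : y₀ ≤ y) :
    Real.exp (-2 * y ^ 3) * ∫ u in (0 : ℝ)..13 / 10, Real.exp (3 * y ^ 2 * u)
      ≤ Real.exp (3 * y₀ ^ 2 * (13 / 10) - 2 * y₀ ^ 3) / (3 * y₀ ^ 2) := by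
  have hy₀' : 0 < y₀ := by linarith
  have hy' : 0 < y := hy₀'.trans_le hy
  have hk : 0 < 3 * y ^ 2 := by positivity
  have h1 := integral_exp_const_mul_le hk (13 / 10)
  have h2 : Real.exp (-2 * y ^ 3) * (Real.exp (3 * y ^ 2 * (13 / 10)) / (3 * y ^ 2))
      = Real.exp (3 * y ^ 2 * (13 / 10) - 2 * y ^ 3) / (3 * y ^ 2) := by
    rw [mul_div_assoc', ← Real.exp_add]; ring_nf
  have h3 : Real.exp (3 * y ^ 2 * (13 / 10) - 2 * y ^ 3)
      ≤ Real.exp (3 * y₀ ^ 2 * (13 / 10) - 2 * y₀ ^ 3) := by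
    apply Real.exp_le_exp.2
    have hA : 0 ≤ y - y₀ := by linarith
    have hB : 0 ≤ 2 * (y₀ ^ 2 + y₀ * y + y ^ 2) - 3 * (13 / 10) * (y₀ + y) := by
      nlinarith [mul_nonneg (by linarith : 0 ≤ y₀ - 13 / 10) hy₀'.le,
        mul_nonneg (by linarith : 0 ≤ y - 13 / 10) hy'.le,
        mul_nonneg (by linarith : 0 ≤ y₀ - 13 / 10) hy'.le,
        mul_nonneg (by linarith : 0 ≤ y - 13 / 10) hy₀'.le]
    nlinarith [mul_nonneg hA hB]
  calc Real.exp (-2 * y ^ 3) * ∫ u in (0 : ℝ)..13 / 10, Real.exp (3 * y ^ 2 * u)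
      ≤ Real.exp (-2 * y ^ 3) * (Real.exp (3 * y ^ 2 * (13 / 10)) / (3 * y ^ 2)) :=
        mul_le_mul_of_nonneg_left h1 (Real.exp_pos _).le
    _ = Real.exp (3 * y ^ 2 * (13 / 10) - 2 * y ^ 3) / (3 * y ^ 2) := h2
    _ ≤ Real.exp (3 * y₀ ^ 2 * (13 / 10) - 2 * y₀ ^ 3) / (3 * y ^ 2) :=
        div_le_div_of_nonneg_right h3 hk.le
    _ ≤ Real.exp (3 * y₀ ^ 2 * (13 / 10) - 2 * y₀ ^ 3) / (3 * y₀ ^ 2) := by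
        apply div_le_div_of_nonneg_left (Real.exp_pos _).le (by positivity)
        nlinarith [mul_pos hy₀' hy']

/-! ## The second term: Gaussian comparisons -/

/-- Pointwise comparison on `u ≥ 13/10`: `(u − y)²(u + 2y) ≥ (13/10 + 2y)(u − y)²`, in exponential
form. [folklore] -/
theorem exp_neg_phi_le_gauss {y u : ℝ} (hu : 13 / 10 ≤ u) :
    Real.exp (-((u - y) ^ 2 * (u + 2 * y))) ≤ Real.exp (-(13 / 10 + 2 * y) * (u - y) ^ 2) := by
  apply Real.exp_le_exp.2
  nlinarith [mul_nonneg (sq_nonneg (u - y)) (by linarith : (0 : ℝ) ≤ u - 13 / 10)]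

/-- Pointwise comparison on `u ≥ y ≥ 0`: `(u − y)²(u + 2y) ≥ 3y (u − y)²`. [folklore] -/
theorem exp_neg_phi_le_gauss' {y u : ℝ} (hu : y ≤ u) :
    Real.exp (-((u - y) ^ 2 * (u + 2 * y))) ≤ Real.exp (-(3 * y) * (u - y) ^ 2) := by
  apply Real.exp_le_exp.2
  nlinarith [mul_nonneg (sq_nonneg (u - y)) (by linarith : (0 : ℝ) ≤ u - y)]

/-- Second term on a cell `y₀ ≤ y ≤ y₁ ≤ 13/10`, Gaussian form:
`∫_{13/10}^{V} e^{−(u−y)²(u+2y)} du ≤ √(π/(13/10 + 2y₀))/2`. [folklore] -/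
theorem term2_le_gauss_of_le {y y₀ V : ℝ} (hy₀ : 0 ≤ y₀) (hy : y₀ ≤ y) (hy₁ : y ≤ 13 / 10)
    (hV : 13 / 10 ≤ V) :
    ∫ u in (13 / 10 : ℝ)..V, Real.exp (-((u - y) ^ 2 * (u + 2 * y)))
      ≤ Real.sqrt (π / (13 / 10 + 2 * y₀)) / 2 := by
  have hyy : 0 ≤ y := hy₀.trans hy
  set m : ℝ := 13 / 10 + 2 * y with hm
  have hm0 : 0 < m := by rw [hm]; linarith
  have h1 : ∫ u in (13 / 10 : ℝ)..V, Real.exp (-((u - y) ^ 2 * (u + 2 * y)))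
      ≤ ∫ u in (13 / 10 : ℝ)..V, Real.exp (-m * (u - y) ^ 2) := by
    refine integral_mono_on hV
      ((by fun_prop : Continuous fun u ↦ Real.exp (-((u - y) ^ 2 * (u + 2 * y)))).intervalIntegrable _ _)
      ((by fun_prop : Continuous fun u ↦ Real.exp (-m * (u - y) ^ 2)).intervalIntegrable _ _) ?_
    intro u hu
    exact exp_neg_phi_le_gauss hu.1
  have h2 : ∫ u in (13 / 10 : ℝ)..V, Real.exp (-m * (u - y) ^ 2)
      = ∫ v in (13 / 10 - y : ℝ)..V - y, Real.exp (-m * v ^ 2) :=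
    intervalIntegral.integral_comp_sub_right (fun v ↦ Real.exp (-m * v ^ 2)) y
  have h3 := integral_gaussian_piece_le hm0 (d := 13 / 10 - y) (e := V - y) (by linarith) (by linarith)
  have h4 : Real.sqrt (π / m) ≤ Real.sqrt (π / (13 / 10 + 2 * y₀)) := by
    apply Real.sqrt_le_sqrt
    exact div_le_div_of_nonneg_left Real.pi_pos.le (by linarith) (by rw [hm]; linarith)
  linarith

/-- Second term on a cell `0 ≤ y₀ ≤ y ≤ y₁ < 13/10`, tail form:
`∫_{13/10}^{V} e^{−(u−y)²(u+2y)} du ≤ e^{−m₀ d₁²}/(2 m₀ d₁)`, `m₀ = 13/10 + 2y₀`, `d₁ = 13/10 − y₁`.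
[folklore] -/
theorem term2_le_tail_of_le {y y₀ y₁ V : ℝ} (hy₀ : 0 ≤ y₀) (hy : y₀ ≤ y) (hy' : y ≤ y₁)
    (hy₁ : y₁ < 13 / 10) (hV : 13 / 10 ≤ V) :
    ∫ u in (13 / 10 : ℝ)..V, Real.exp (-((u - y) ^ 2 * (u + 2 * y)))
      ≤ Real.exp (-(13 / 10 + 2 * y₀) * (13 / 10 - y₁) ^ 2)
          / (2 * (13 / 10 + 2 * y₀) * (13 / 10 - y₁)) := by
  have hyy : 0 ≤ y := hy₀.trans hy
  set m : ℝ := 13 / 10 + 2 * y with hm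
  have hm0 : 0 < m := by rw [hm]; linarith
  set d : ℝ := 13 / 10 - y with hd
  have hd0 : 0 < d := by rw [hd]; linarith
  have h1 : ∫ u in (13 / 10 : ℝ)..V, Real.exp (-((u - y) ^ 2 * (u + 2 * y)))
      ≤ ∫ u in (13 / 10 : ℝ)..V, Real.exp (-m * (u - y) ^ 2) := by
    refine integral_mono_on hV
      ((by fun_prop : Continuous fun u ↦ Real.exp (-((u - y) ^ 2 * (u + 2 * y)))).intervalIntegrable _ _)
      ((by fun_prop : Continuous fun u ↦ Real.exp (-m * (u - y) ^ 2)).intervalIntegrable _ _) ?_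
    intro u hu
    exact exp_neg_phi_le_gauss hu.1
  have h2 : ∫ u in (13 / 10 : ℝ)..V, Real.exp (-m * (u - y) ^ 2)
      = ∫ v in (13 / 10 - y : ℝ)..V - y, Real.exp (-m * v ^ 2) :=
    intervalIntegral.integral_comp_sub_right (fun v ↦ Real.exp (-m * v ^ 2)) y
  have h3 := integral_gaussian_tail_le hm0 (d := d) (e := V - y) hd0 (by rw [hd]; linarith)
  -- monotonicity in the cell: `m ≥ m₀`, `d ≥ d₁`
  set m₀ : ℝ := 13 / 10 + 2 * y₀ with hm₀
  set d₁ : ℝ := 13 / 10 - y₁ with hd₁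
  have hm₀0 : 0 < m₀ := by rw [hm₀]; linarith
  have hd₁0 : 0 < d₁ := by rw [hd₁]; linarith
  have hmm : m₀ ≤ m := by rw [hm₀, hm]; linarith
  have hdd : d₁ ≤ d := by rw [hd₁, hd]; linarith
  have h4 : Real.exp (-m * d ^ 2) ≤ Real.exp (-m₀ * d₁ ^ 2) := by
    apply Real.exp_le_exp.2
    have : d₁ ^ 2 ≤ d ^ 2 := pow_le_pow_left₀ hd₁0.le hdd 2
    nlinarith [mul_le_mul hmm this (by positivity) hm0.le]
  have h5 : 2 * m₀ * d₁ ≤ 2 * m * d := by nlinarith [mul_le_mul hmm hdd hd₁0.le hm0.le]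
  have h6 : Real.exp (-m * d ^ 2) / (2 * m * d) ≤ Real.exp (-m₀ * d₁ ^ 2) / (2 * m₀ * d₁) :=
    div_le_div₀ (Real.exp_pos _).le h4 (by positivity) h5
  have e13 : (13 / 10 - y : ℝ) = d := by rw [hd]
  rw [e13] at h2
  linarith

/-- Second term on a cell `13/10 ≤ y₀ ≤ y ≤ y₁`: splitting the integral at `u = y`,
`∫_{13/10}^{V} e^{−(u−y)²(u+2y)} du ≤ min(y₁ − 13/10, √(π/(13/10+2y₀))/2) + √(π/(3y₀))/2`; here
the form with both alternatives as separate conclusions. [folklore] -/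
theorem term2_le_of_ge {y y₀ y₁ V : ℝ} (hy₀ : 13 / 10 ≤ y₀) (hy : y₀ ≤ y) (hy' : y ≤ y₁)
    (hV : 13 / 10 ≤ V) :
    ∫ u in (13 / 10 : ℝ)..V, Real.exp (-((u - y) ^ 2 * (u + 2 * y)))
        ≤ (y₁ - 13 / 10) + Real.sqrt (π / (3 * y₀)) / 2
      ∧ ∫ u in (13 / 10 : ℝ)..V, Real.exp (-((u - y) ^ 2 * (u + 2 * y)))
        ≤ Real.sqrt (π / (13 / 10 + 2 * y₀)) / 2 + Real.sqrt (π / (3 * y₀)) / 2 := by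
  have hy13 : 13 / 10 ≤ y := hy₀.trans hy
  have hyy : 0 ≤ y := by linarith
  have hy0' : 0 < y := by linarith
  set f : ℝ → ℝ := fun u ↦ Real.exp (-((u - y) ^ 2 * (u + 2 * y))) with hf
  have hfc : Continuous f := by rw [hf]; fun_prop
  have hf0 : ∀ u, 0 ≤ f u := fun u ↦ (Real.exp_pos _).le
  set V' : ℝ := max V y with hV'
  -- enlarge the interval to `[13/10, V']` and split at `y`
  have hmono : ∫ u in (13 / 10 : ℝ)..V, f u ≤ ∫ u in (13 / 10 : ℝ)..V', f u :=
    integral_mono_interval le_rfl hV (le_max_left _ _)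
      (Filter.Eventually.of_forall fun u ↦ hf0 u) (hfc.intervalIntegrable _ _)
  have hsplit : ∫ u in (13 / 10 : ℝ)..V', f u = (∫ u in (13 / 10 : ℝ)..y, f u) + ∫ u in y..V', f u :=
    (integral_add_adjacent_intervals (hfc.intervalIntegrable _ _) (hfc.intervalIntegrable _ _)).symm
  -- piece 1, Gaussian comparison with `m = 13/10 + 2y`
  set m : ℝ := 13 / 10 + 2 * y with hm
  have hm0 : 0 < m := by rw [hm]; linarith
  have hp1 : ∫ u in (13 / 10 : ℝ)..y, f u ≤ ∫ u in (13 / 10 : ℝ)..y, Real.exp (-m * (u - y) ^ 2) := by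
    refine integral_mono_on hy13 (hfc.intervalIntegrable _ _)
      ((by fun_prop : Continuous fun u ↦ Real.exp (-m * (u - y) ^ 2)).intervalIntegrable _ _) ?_
    intro u hu
    exact exp_neg_phi_le_gauss hu.1
  have hp1a : ∫ u in (13 / 10 : ℝ)..y, Real.exp (-m * (u - y) ^ 2) ≤ y₁ - 13 / 10 := by
    have : ∫ u in (13 / 10 : ℝ)..y, Real.exp (-m * (u - y) ^ 2) ≤ ∫ u in (13 / 10 : ℝ)..y, (1 : ℝ) := by
      refine integral_mono_on hy13
        ((by fun_prop : Continuous fun u ↦ Real.exp (-m * (u - y) ^ 2)).intervalIntegrable _ _)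
        (continuous_const.intervalIntegrable _ _) ?_
      intro u _
      rw [Real.exp_le_one_iff]
      nlinarith [sq_nonneg (u - y)]
    rw [intervalIntegral.integral_const, smul_eq_mul, mul_one] at this
    linarith
  have hp1b : ∫ u in (13 / 10 : ℝ)..y, Real.exp (-m * (u - y) ^ 2)
      ≤ Real.sqrt (π / (13 / 10 + 2 * y₀)) / 2 := by
    have e1 : ∫ u in (13 / 10 : ℝ)..y, Real.exp (-m * (u - y) ^ 2)
        = ∫ v in (13 / 10 - y : ℝ)..y - y, Real.exp (-m * v ^ 2) :=
      intervalIntegral.integral_comp_sub_right (fun v ↦ Real.exp (-m * v ^ 2)) y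
    have e2 : ∫ v in (13 / 10 - y : ℝ)..y - y, Real.exp (-m * v ^ 2)
        = ∫ w in (-(y - y) : ℝ)..-(13 / 10 - y), Real.exp (-m * w ^ 2) := by
      rw [← intervalIntegral.integral_comp_neg (fun w ↦ Real.exp (-m * w ^ 2))]
      refine integral_congr fun w _ ↦ ?_
      simp only [even_two, Even.neg_pow]
    have e3 := integral_gaussian_piece_le hm0 (d := -(y - y)) (e := -(13 / 10 - y)) (by simp) (by linarith)
    have h4 : Real.sqrt (π / m) ≤ Real.sqrt (π / (13 / 10 + 2 * y₀)) := by
      apply Real.sqrt_le_sqrt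
      exact div_le_div_of_nonneg_left Real.pi_pos.le (by linarith) (by rw [hm]; linarith)
    linarith
  -- piece 2, Gaussian comparison with `m' = 3y`
  have hp2 : ∫ u in y..V', f u ≤ Real.sqrt (π / (3 * y₀)) / 2 := by
    have hyV' : y ≤ V' := le_max_right _ _
    have h1 : ∫ u in y..V', f u ≤ ∫ u in y..V', Real.exp (-(3 * y) * (u - y) ^ 2) := by
      refine integral_mono_on hyV' (hfc.intervalIntegrable _ _)
        ((by fun_prop : Continuous fun u ↦ Real.exp (-(3 * y) * (u - y) ^ 2)).intervalIntegrable _ _) ?_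
      intro u hu
      exact exp_neg_phi_le_gauss' hu.1
    have e1 : ∫ u in y..V', Real.exp (-(3 * y) * (u - y) ^ 2)
        = ∫ v in (y - y : ℝ)..V' - y, Real.exp (-(3 * y) * v ^ 2) :=
      intervalIntegral.integral_comp_sub_right (fun v ↦ Real.exp (-(3 * y) * v ^ 2)) y
    have e3 := integral_gaussian_piece_le (m := 3 * y) (by positivity) (d := y - y) (e := V' - y)
      (by simp) (by linarith)
    have h4 : Real.sqrt (π / (3 * y)) ≤ Real.sqrt (π / (3 * y₀)) := by
      apply Real.sqrt_le_sqrt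
      exact div_le_div_of_nonneg_left Real.pi_pos.le (by linarith) (by linarith)
    linarith
  constructor <;> linarith

/-! ## Numerical constants -/

/-- `e^{1.911} ≤ 6.76`. [folklore] -/
theorem exp_1911_le : Real.exp (3 * (7 / 10) ^ 2 * (13 / 10)) ≤ 6.76 := by
  have := VK.exp_le_of_expUB_le (k := 1) (f := 0.911) (X := 6.76) (by norm_num) (by norm_num)
    (by norm_num [VK.expUB])
  convert this using 2; norm_num

/-- `e^{(13/10)³} = e^{2.197} ≤ 9`. [folklore] -/
theorem exp_cube_le : Real.exp ((13 / 10) ^ 3) ≤ 9 := by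
  have := VK.exp_le_of_expUB_le (k := 2) (f := 0.197) (X := 9) (by norm_num) (by norm_num)
    (by norm_num [VK.expUB])
  convert this using 2; norm_num

/-- `e^{p(1.6)} = e^{1.792} ≤ 6.01`. [folklore] -/
theorem exp_p16_le : Real.exp (3 * (8 / 5) ^ 2 * (13 / 10) - 2 * (8 / 5) ^ 3) ≤ 6.01 := by
  have := VK.exp_le_of_expUB_le (k := 1) (f := 0.792) (X := 6.01) (by norm_num) (by norm_num)
    (by norm_num [VK.expUB])
  convert this using 2; norm_num

/-- `e^{−c} ≤ X` from `1 ≤ X (1 + c + c²/2)` (`c ≥ 0`). [folklore] -/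
theorem exp_neg_le_of_quadratic {c X : ℝ} (hc : 0 ≤ c) (hX : 0 ≤ X) (h : 1 ≤ X * (1 + c + c ^ 2 / 2)) :
    Real.exp (-c) ≤ X := by
  have h1 := Real.quadratic_le_exp_of_nonneg hc
  have h2 : Real.exp (-c) * Real.exp c = 1 := by rw [← Real.exp_add]; simp
  nlinarith [Real.exp_pos (-c), Real.exp_pos c, mul_le_mul_of_nonneg_left h1 hX]

/-- `√(π/m)/2 ≤ g` from `π ≤ 3.1416 ≤ 4 g² m`. [folklore] -/
theorem sqrt_pi_div_le {m g : ℝ} (hm : 0 < m) (hg : 0 ≤ g) (h : 3.1416 ≤ 4 * g ^ 2 * m) :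
    Real.sqrt (π / m) / 2 ≤ g := by
  rw [div_le_iff₀ (by norm_num : (0 : ℝ) < 2), Real.sqrt_le_left (by positivity),
    div_le_iff₀ hm]
  nlinarith [Real.pi_lt_d4]

/-! ## The `κ`-lemma -/

/-- **The `κ`-lemma.** For all `y ≥ 0` and `V ≥ 13/10`,
`e^{−2y³} ∫_0^{13/10} e^{3y²u} du + 9.463 ∫_{13/10}^{V} e^{−(u−y)²(u+2y)} du ≤ 10`
(the true supremum is `≈ 7.06`, attained near `y = 1.75`; seven cells with closed-form
majorants). [cite: Ford2002, Lemma 7.3 (proof; replaces the constant 1.0875034·C)] -/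
theorem kappa_le {y V : ℝ} (hy : 0 ≤ y) (hV : 13 / 10 ≤ V) :
    Real.exp (-2 * y ^ 3) * (∫ u in (0 : ℝ)..13 / 10, Real.exp (3 * y ^ 2 * u))
      + 9.463 * ∫ u in (13 / 10 : ℝ)..V, Real.exp (-((u - y) ^ 2 * (u + 2 * y))) ≤ 10 := by
  have hE9 := exp_cube_le
  rcases le_or_gt y (7 / 10) with h07 | h07
  · -- cell [0, 0.7]: `3.92 + 9.463 · 0.4071 ≤ 10`
    have hP := term1_le_of_le hy h07 (by norm_num)
    have hQ := term2_le_tail_of_le le_rfl hy h07 (by norm_num) hV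
    have hN1 := exp_1911_le
    have hN2 : Real.exp (-(13 / 10 + 2 * 0) * (13 / 10 - 7 / 10) ^ 2) ≤ 0.635 := by
      have := exp_neg_le_of_quadratic (c := 0.468) (X := 0.635) (by norm_num) (by norm_num) (by norm_num)
      convert this using 2; norm_num
    have hP' : (Real.exp (3 * (7 / 10) ^ 2 * (13 / 10)) - 1) / (3 * (7 / 10) ^ 2) ≤ 3.92 := by
      rw [div_le_iff₀ (by norm_num)]; linarith
    have hQ' : Real.exp (-(13 / 10 + 2 * 0) * (13 / 10 - 7 / 10) ^ 2)
        / (2 * (13 / 10 + 2 * 0) * (13 / 10 - 7 / 10)) ≤ 0.4071 := by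
      rw [div_le_iff₀ (by norm_num)]; linarith
    linarith
  rcases le_or_gt y (9 / 10) with h09 | h09
  · -- cell [0.7, 0.9]: `6.123 + 9.463 · 0.3038 ≤ 10`
    have hP := term1_le_of_ge (by norm_num : (0 : ℝ) < 7 / 10) h07.le
    have hQ := term2_le_tail_of_le (by norm_num) h07.le h09 (by norm_num) hV
    have hN2 : Real.exp (-(13 / 10 + 2 * (7 / 10)) * (13 / 10 - 9 / 10) ^ 2) ≤ 0.656 := by
      have := exp_neg_le_of_quadratic (c := 0.432) (X := 0.656) (by norm_num) (by norm_num) (by norm_num)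
      convert this using 2; norm_num
    have hP' : Real.exp ((13 / 10) ^ 3) / (3 * (7 / 10) ^ 2) ≤ 6.123 := by
      rw [div_le_iff₀ (by norm_num)]; linarith
    have hQ' : Real.exp (-(13 / 10 + 2 * (7 / 10)) * (13 / 10 - 9 / 10) ^ 2)
        / (2 * (13 / 10 + 2 * (7 / 10)) * (13 / 10 - 9 / 10)) ≤ 0.3038 := by
      rw [div_le_iff₀ (by norm_num)]; linarith
    linarith
  rcases le_or_gt y 1 with h10 | h10
  · -- cell [0.9, 1.0]: `3.704 + 9.463 · 0.4081 ≤ 10`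
    have hP := term1_le_of_ge (by norm_num : (0 : ℝ) < 9 / 10) h09.le
    have hQ := term2_le_tail_of_le (by norm_num) h09.le h10 (by norm_num) hV
    have hN2 : Real.exp (-(13 / 10 + 2 * (9 / 10)) * (13 / 10 - 1) ^ 2) ≤ 0.759 := by
      have := exp_neg_le_of_quadratic (c := 0.279) (X := 0.759) (by norm_num) (by norm_num) (by norm_num)
      convert this using 2; norm_num
    have hP' : Real.exp ((13 / 10) ^ 3) / (3 * (9 / 10) ^ 2) ≤ 3.704 := by
      rw [div_le_iff₀ (by norm_num)]; linarith
    have hQ' : Real.exp (-(13 / 10 + 2 * (9 / 10)) * (13 / 10 - 1) ^ 2)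
        / (2 * (13 / 10 + 2 * (9 / 10)) * (13 / 10 - 1)) ≤ 0.4081 := by
      rw [div_le_iff₀ (by norm_num)]; linarith
    linarith
  rcases le_or_gt y (13 / 10) with h13 | h13
  · -- cell [1.0, 1.3]: `3 + 9.463 · 0.488 ≤ 10`
    have hP := term1_le_of_ge (by norm_num : (0 : ℝ) < 1) h10.le
    have hQ := term2_le_gauss_of_le (by norm_num) h10.le h13 hV
    have hG : Real.sqrt (π / (13 / 10 + 2 * 1)) / 2 ≤ 0.488 :=
      sqrt_pi_div_le (by norm_num) (by norm_num) (by norm_num)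
    have hP' : Real.exp ((13 / 10) ^ 3) / (3 * (1 : ℝ) ^ 2) ≤ 3 := by
      rw [div_le_iff₀ (by norm_num)]; linarith
    linarith
  rcases le_or_gt y (8 / 5) with h16 | h16
  · -- cell [1.3, 1.6]: `1.776 + 9.463 · 0.749 ≤ 10`
    have hP := term1_le_of_ge' le_rfl h13.le
    have hQ := (term2_le_of_ge le_rfl h13.le h16 hV).1
    have hG : Real.sqrt (π / (3 * (13 / 10))) / 2 ≤ 0.449 :=
      sqrt_pi_div_le (by norm_num) (by norm_num) (by norm_num)
    have e : (3 * (13 / 10) ^ 2 * (13 / 10) - 2 * (13 / 10) ^ 3 : ℝ) = (13 / 10) ^ 3 := by norm_num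
    rw [e] at hP
    have hP' : Real.exp ((13 / 10) ^ 3) / (3 * (13 / 10) ^ 2) ≤ 1.776 := by
      rw [div_le_iff₀ (by norm_num)]; linarith
    linarith
  rcases le_or_gt y (11 / 5) with h22 | h22
  · -- cell [1.6, 2.2]: `0.783 + 9.463 · 0.823 ≤ 10`
    have hP := term1_le_of_ge' (by norm_num) h16.le
    have hQ := (term2_le_of_ge (by norm_num) h16.le h22 hV).2
    have hG1 : Real.sqrt (π / (13 / 10 + 2 * (8 / 5))) / 2 ≤ 0.418 :=
      sqrt_pi_div_le (by norm_num) (by norm_num) (by norm_num)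
    have hG2 : Real.sqrt (π / (3 * (8 / 5))) / 2 ≤ 0.405 :=
      sqrt_pi_div_le (by norm_num) (by norm_num) (by norm_num)
    have hN := exp_p16_le
    have hP' : Real.exp (3 * (8 / 5) ^ 2 * (13 / 10) - 2 * (8 / 5) ^ 3) / (3 * (8 / 5) ^ 2) ≤ 0.783 := by
      rw [div_le_iff₀ (by norm_num)]; linarith
    linarith
  · -- cell [2.2, ∞): `0.069 + 9.463 · 0.718 ≤ 10`
    have hP := term1_le_of_ge' (by norm_num) h22.le
    have hQ := (term2_le_of_ge (by norm_num) h22.le le_rfl hV).2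
    have hG1 : Real.sqrt (π / (13 / 10 + 2 * (11 / 5))) / 2 ≤ 0.372 :=
      sqrt_pi_div_le (by norm_num) (by norm_num) (by norm_num)
    have hG2 : Real.sqrt (π / (3 * (11 / 5))) / 2 ≤ 0.346 :=
      sqrt_pi_div_le (by norm_num) (by norm_num) (by norm_num)
    have hE : Real.exp (3 * (11 / 5) ^ 2 * (13 / 10) - 2 * (11 / 5) ^ 3) ≤ 1 := by
      rw [Real.exp_le_one_iff]; norm_num
    have hP' : Real.exp (3 * (11 / 5) ^ 2 * (13 / 10) - 2 * (11 / 5) ^ 3) / (3 * (11 / 5) ^ 2)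
        ≤ 0.069 := by
      rw [div_le_iff₀ (by norm_num)]; linarith
    linarith

/-- The `κ`-lemma in the form consumed by `FordZetaBoundMain.lean`: for `y ≥ 0`, `V ≥ 13/10`,
`e^{−2y³} (∫_0^{13/10} e^{3y²u} du + 9.463 ∫_{13/10}^{V} e^{3y²u − u³} du) ≤ 10`.
[cite: Ford2002, Lemma 7.3 (proof)] -/
theorem kappa_le' {y V : ℝ} (hy : 0 ≤ y) (hV : 13 / 10 ≤ V) :
    Real.exp (-2 * y ^ 3) * ((∫ u in (0 : ℝ)..13 / 10, Real.exp (3 * y ^ 2 * u))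
      + 9.463 * ∫ u in (13 / 10 : ℝ)..V, Real.exp (3 * y ^ 2 * u - u ^ 3)) ≤ 10 := by
  have h := kappa_le hy hV
  have e1 : Real.exp (-2 * y ^ 3) * (9.463 * ∫ u in (13 / 10 : ℝ)..V, Real.exp (3 * y ^ 2 * u - u ^ 3))
      = 9.463 * ∫ u in (13 / 10 : ℝ)..V, Real.exp (-((u - y) ^ 2 * (u + 2 * y))) := by
    rw [mul_left_comm, ← intervalIntegral.integral_const_mul]
    congr 1
    refine integral_congr fun u _ ↦ ?_
    exact exp_neg_two_cube_mul_exp y u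
  rw [mul_add, e1]
  exact h

end FordVK

end Literature.NumberTheory.LFunctions
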